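import Literature.NumberTheory.Sieve.HeathBrownCubicLemma95
import Mathlib.MeasureTheory.Measure.Lebesgue.EqHaar
import Mathlib.Analysis.SpecialFunctions.PolarCoord
import HarnessLib

/-!
# The orbit integral `I(β) = γ₀Δ³V` of Heath-Brown's §9 (p. 59–60)

Part of the reduction *Lemma 9.2 ⇐ Lemma 9.4* (this seat's route to `HeathBrown2001_lemma_3_8`; see
`HeathBrownCubicGrossen`, `HeathBrownCubicLemma95`). On pp. 59–60 of *Primes represented by `x³ + 2y³`*
(Acta Math. 186 (2001)) Heath-Brown evaluates, for a generator `β` of an ideal `S`,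
`I(β) = ∫_{𝐱 ∈ 𝓕, N(𝐱) < N(β) ≤ N(𝐱)+ΔV} W((β); Δ, 𝐱) dx dy dz`: "We make a change of variables by
setting `β(𝐱) = y`, `β'(𝐱) = z`. A straightforward computation shows that the Jacobian of this
transformation is … Thus, if `θ_i = arg(ν_i(β))`, then `I(β) = … ∫ h(θ₂ − 2πv⁻¹log y) I₁(y) I₂(y) dy`, where
`I₁(y) = ∫_{N(β)−ΔV ≤ r²y < N(β)} r dr = ΔV/2y` and `I₂(y) = ∫ h(θ₁ − uv⁻¹ log y − θ) dθ = 2πΔ`. An easy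
calculation now reveals that `I(β) = (πv/(3√3)) Δ³V = γ₀Δ³V`." This file PROVES it, with the branch
`Near b 𝐱` of `HeathBrownCubicLemma95` in place of the fundamental domain `𝓕`:

* `embT 𝐱 = (β(𝐱), Re β'(𝐱), Im β'(𝐱))` on `ℝ³`, **`det_embT : det T = 3√3`** (`= √|d_K|/2^{r₂}`; the
  `3 × 3` determinant in the basis `coeffBasis`), the pushforward `map_embT_volume` of Lebesgue measure
  and the change of variables **`integral_comp_embT : ∫ F(T𝐱) d𝐱 = (3√3)⁻¹ ∫ F`** (for every `F`);
* the three one-dimensional integrals: `integral_tentPer_angle` (`I₂ = 2πΔ`), `integral_radial`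
  (`I₁ = (N₂ − N₁)/2y`) and `integral_unitCoord_factor` (`∫ h(2πσ(y)) dy/y = vΔ` over the branch, by the
  substitution `s = σ(y) = (log y − log β(b))/v`);
* the integrand in the coordinates `(y, z)`: `orbitG = A(y)·B(y, z)` (`orbitA`, `orbitB`, `sigmaOf`), its
  measurability, the bound `|G| ≤ 1`, its bounded support, `integrable_orbitG`, the inner `z`-integral by
  polar coordinates (`integral_orbitB`, Mathlib's `integral_comp_polarCoord_symm`) and Fubini
  (`integral_orbitG : ∫ G = πvΔ³V`);
* **`orbitSet Δ V b`** (`D(b) = {𝐱 : β(𝐱) > 0, Near b 𝐱, N(b) − ΔV ≤ N(𝐱) < N(b)}`),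
  **`orbitIntegrand = 𝟙_{D(b)} · W(b; Δ, ·)`**, the pointwise identity `orbitIntegrand = G ∘ T`
  (`orbitIntegrand_eq_orbitG`, from the polar forms of `ν₁(b)/ν₁(𝐱)`, `ν₂(b)/ν₂(𝐱)` of `HeathBrownCubicLemma95`),
  `integrable_orbitIntegrand`, and **`integral_orbitIntegrand : ∫ 𝟙_{D(b)} W = γ₀Δ³V`** for `0 < Δ ≤ 1/2`,
  `V > 0`, `β(b) > 0`, `ΔV < N(b)` — with `γ₀` the residue of `ζ_K` through `gamma₀_eq`
  (`HeathBrownCubicRegulator`: `γ₀ = π log E/(3√3)`).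

## References

* D. R. Heath-Brown, *Primes represented by `x³ + 2y³`*, Acta Math. 186 (2001), §9 pp. 59–60.
  [cite: HeathBrownActa2001, §9 p. 60]
* G. Harman, *Prime-Detecting Sieves* (2007), §13.6 pp. 276–277. [cite: Harman2007, §13.6]

## Mathlib / tree search

Mathlib: `Measure.map_linearMap_addHaar_eq_smul_addHaar`, `integral_map_equiv`, `integrable_map_equiv`,
`LinearMap.det_toMatrix`, `Matrix.det_fin_three`, `Basis.ofEquivFun`, `LinearMap.equivOfDetNeZero`,
`integral_comp_polarCoord_symm`, `polarCoord_symm_apply`, `Complex.arg_mul_cos_add_sin_mul_I`,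
`setIntegral_prod_mul`, `integral_prod`, `Measure.integrableOn_of_bounded`, `integrableOn_iff_integrable_of_support_subset`,
`intervalIntegral.integral_comp_mul_deriv'`, `intervalIntegral.integral_comp_sub_left`, `intervalIntegral.integral_comp_div`,
`integral_id`, `Ico_ae_eq_Ioc`, `Ioo_ae_eq_Ioc`. Tree: `TentFunction` (`integral_tentPer`, `continuous_tentPer`),
`HeathBrownCubicLemma95` (`Near`, `unitCoord`, `pairWeight`, `angTent_nu1_div`, `angTent_nu2_div`), `HeathBrownCubicPolar`
(`cplxEmb`, `ell_mul_normSq_cplxEmb`, `ell_add/smul`, `cplxEmb_add/smul`), `HeathBrownCubicRegulator` (`gamma₀_eq`).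
-/

noncomputable section

open Polynomial NumberField Finset Complex MeasureTheory Module

namespace Literature.NumberTheory.Sieve.CubicSieve

open LFunctions.CubeRootTwoField CubicPrimes Literature.Analysis.Fourier

/-! ### The coordinate map `T(𝐱) = (β(𝐱), Re β'(𝐱), Im β'(𝐱))` and its determinant -/

/-- The linear equivalence `ℝ³ ≃ (Fin 3 → ℝ)` (coordinates). [folklore] -/
def coeffEquivFun : (ℝ × ℝ × ℝ) ≃ₗ[ℝ] (Fin 3 → ℝ) where
  toFun x := ![x.1, x.2.1, x.2.2]
  invFun v := (v 0, v 1, v 2)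
  map_add' x y := by funext i; fin_cases i <;> rfl
  map_smul' c x := by funext i; fin_cases i <;> rfl
  left_inv x := rfl
  right_inv v := by funext i; fin_cases i <;> rfl

/-- The standard basis of `ℝ³` indexed by `Fin 3`. [folklore] -/
def coeffBasis : Basis (Fin 3) ℝ (ℝ × ℝ × ℝ) := Basis.ofEquivFun coeffEquivFun

/-- **The coordinate map `T(𝐱) = (β(𝐱), Re β'(𝐱), Im β'(𝐱))`** (the change of variables of p. 59,
"`β(𝐱) = y`, `β'(𝐱) = z`", with `z` in real coordinates). [cite: HeathBrownActa2001, §9 p. 59] -/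
def embT : (ℝ × ℝ × ℝ) →ₗ[ℝ] (ℝ × ℝ × ℝ) where
  toFun x := (ell x, (cplxEmb x).re, (cplxEmb x).im)
  map_add' x y := by
    refine Prod.ext ?_ (Prod.ext ?_ ?_) <;> simp [ell_add, cplxEmb_add]
  map_smul' c x := by
    refine Prod.ext ?_ (Prod.ext ?_ ?_) <;> simp [ell_smul, cplxEmb_smul]

/-- Unfolding of `embT`. [folklore] -/
@[simp] theorem embT_apply (x : ℝ × ℝ × ℝ) : embT x = (ell x, (cplxEmb x).re, (cplxEmb x).im) := rfl

/-- **`det T = 3√3`** ("A straightforward computation shows that the Jacobian of this transformation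
is …", p. 59: `|det| = √|d_K|/2^{r₂} = √108/2`). [cite: HeathBrownActa2001, §9 p. 59] -/
theorem det_embT : LinearMap.det embT = 3 * Real.sqrt 3 := by
  have hρ : rho ^ 3 = 2 := rho_pow_three
  have hs : Real.sqrt 3 ^ 2 = 3 := Real.sq_sqrt (by norm_num)
  rw [← LinearMap.det_toMatrix coeffBasis, Matrix.det_fin_three]
  simp only [LinearMap.toMatrix_apply, coeffBasis, Basis.ofEquivFun_repr_apply, Basis.coe_ofEquivFun]
  simp [coeffEquivFun, embT, ell, cplxEmb, Fin.isValue]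
  linear_combination (3 * Real.sqrt 3 / 2) * hρ

/-- `det T ≠ 0`. [folklore] -/
theorem det_embT_ne_zero : LinearMap.det embT ≠ 0 := by rw [det_embT]; positivity

/-- `T` as a continuous linear automorphism of `ℝ³`. [folklore] -/
def embTEquiv : (ℝ × ℝ × ℝ) ≃L[ℝ] (ℝ × ℝ × ℝ) :=
  (LinearMap.equivOfDetNeZero embT det_embT_ne_zero).toContinuousLinearEquiv

/-- `embTEquiv` is `T`. [folklore] -/
@[simp] theorem embTEquiv_apply (x : ℝ × ℝ × ℝ) : embTEquiv x = embT x := by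
  simp [embTEquiv, LinearMap.equivOfDetNeZero]

/-- Lebesgue measure on `ℝ³ = ℝ × (ℝ × ℝ)` is an additive Haar measure (the product instance, which
instance search does not find through `volume`). [folklore] -/
theorem isAddHaarMeasure_volume_coeff : (volume : Measure (ℝ × ℝ × ℝ)).IsAddHaarMeasure := by
  haveI : (volume : Measure (ℝ × ℝ)).IsAddHaarMeasure := Measure.prod.instIsAddHaarMeasure _ _
  exact Measure.prod.instIsAddHaarMeasure _ _

/-- **The pushforward of Lebesgue measure under `T` is `(3√3)⁻¹ ·` Lebesgue measure.** [folklore] -/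
theorem map_embT_volume :
    Measure.map embT (volume : Measure (ℝ × ℝ × ℝ)) = ENNReal.ofReal (3 * Real.sqrt 3)⁻¹ • volume := by
  haveI := isAddHaarMeasure_volume_coeff
  have h := Measure.map_linearMap_addHaar_eq_smul_addHaar (μ := (volume : Measure (ℝ × ℝ × ℝ))) det_embT_ne_zero
  rw [det_embT, abs_of_pos (by positivity)] at h
  exact h

/-- **Change of variables in `𝐱 ↦ (β(𝐱), Re β'(𝐱), Im β'(𝐱))`**:
`∫ F(T𝐱) d𝐱 = (3√3)⁻¹ ∫ F(𝐲) d𝐲` for every `F : ℝ³ → ℝ` (no measurability needed: `T` is a measurable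
equivalence). This is "`dx dy dz = (3√3)⁻¹ dy d²z`" of the Jacobian computation on p. 59.
[cite: HeathBrownActa2001, §9 p. 59] -/
theorem integral_comp_embT (F : ℝ × ℝ × ℝ → ℝ) :
    ∫ x, F (embT x) = (3 * Real.sqrt 3)⁻¹ * ∫ y, F y := by
  let e : (ℝ × ℝ × ℝ) ≃ᵐ (ℝ × ℝ × ℝ) := embTEquiv.toHomeomorph.toMeasurableEquiv
  have he : (⇑e : (ℝ × ℝ × ℝ) → ℝ × ℝ × ℝ) = ⇑embT := by
    funext x; exact embTEquiv_apply x
  have h1 := integral_map_equiv (μ := (volume : Measure (ℝ × ℝ × ℝ))) e F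
  rw [he, map_embT_volume, integral_smul_measure, ENNReal.toReal_ofReal (by positivity)] at h1
  rw [← h1]
  rfl

/-! ### The three one-dimensional integrals of p. 60 -/

/-- **`I₂ = 2πΔ`**: the angular integral of the `ν₁`-factor over a period,
`∫_{−π}^{π} h((d − θ)) dθ = 2πΔ` in Heath-Brown's notation ("`I₂(y) = ∫ h(θ₁ − 2πv⁻¹ log y − θ) dθ = 2πΔ`",
p. 60). [cite: HeathBrownActa2001, §9 p. 60] -/
theorem integral_tentPer_angle {Δ : ℝ} (hΔ : 0 < Δ) (hΔ2 : Δ ≤ 1 / 2) (d : ℝ) :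
    ∫ θ in (-Real.pi)..Real.pi, tentPer Δ ((d - θ) / (2 * Real.pi)) = 2 * Real.pi * Δ := by
  have h2π := Real.two_pi_pos
  have h1 : ∫ θ in (-Real.pi)..Real.pi, tentPer Δ ((d - θ) / (2 * Real.pi)) =
      ∫ θ in (d - Real.pi)..(d - -Real.pi), tentPer Δ (θ / (2 * Real.pi)) :=
    intervalIntegral.integral_comp_sub_left (fun θ => tentPer Δ (θ / (2 * Real.pi))) d
  rw [h1, intervalIntegral.integral_comp_div (fun θ => tentPer Δ θ) h2π.ne', smul_eq_mul]
  have h3 : (d - -Real.pi) / (2 * Real.pi) = (d - Real.pi) / (2 * Real.pi) + 1 := by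
    field_simp; ring
  rw [h3, integral_tentPer hΔ hΔ2]

/-- **`I₁ = ΔV/(2y)`**, the radial integral: for `y > 0` and `0 < N₁ ≤ N₂`,
`∫_{r>0} r·𝟙[N₁ ≤ y r² < N₂] dr = (N₂ − N₁)/(2y)` ("`I₁(y) = ∫_{N(β)−ΔV ≤ r²y < N(β)} r dr = ΔV/2y`", p. 60).
[cite: HeathBrownActa2001, §9 p. 60] -/
theorem integral_radial {y N₁ N₂ : ℝ} (hy : 0 < y) (hN₁ : 0 < N₁) (hN : N₁ ≤ N₂) :
    ∫ r in Set.Ioi (0 : ℝ), r * (Set.Ico N₁ N₂).indicator (fun _ => (1 : ℝ)) (y * r ^ 2) =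
      (N₂ - N₁) / (2 * y) := by
  set r₁ : ℝ := Real.sqrt (N₁ / y) with hr₁
  set r₂ : ℝ := Real.sqrt (N₂ / y) with hr₂
  have hr₁0 : 0 < r₁ := Real.sqrt_pos.mpr (div_pos hN₁ hy)
  have hr₁₂ : r₁ ≤ r₂ := Real.sqrt_le_sqrt (by gcongr)
  have key : ∀ r ∈ Set.Ioi (0 : ℝ), r * (Set.Ico N₁ N₂).indicator (fun _ => (1 : ℝ)) (y * r ^ 2) =
      (Set.Ico r₁ r₂).indicator (fun r => r) r := by
    intro r hr
    have hr0 : 0 ≤ r := le_of_lt hr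
    have hrr : Real.sqrt (r ^ 2) = r := Real.sqrt_sq hr0
    have e1 : N₁ ≤ y * r ^ 2 ↔ r₁ ≤ r := by
      rw [hr₁, ← hrr, Real.sqrt_le_sqrt_iff (sq_nonneg r), hrr, div_le_iff₀ hy, mul_comm]
    have e2 : y * r ^ 2 < N₂ ↔ r < r₂ := by
      rw [hr₂, ← hrr, Real.sqrt_lt_sqrt_iff (sq_nonneg r), hrr, lt_div_iff₀ hy, mul_comm]
    have hiff : y * r ^ 2 ∈ Set.Ico N₁ N₂ ↔ r ∈ Set.Ico r₁ r₂ := by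
      rw [Set.mem_Ico, Set.mem_Ico, e1, e2]
    by_cases h : y * r ^ 2 ∈ Set.Ico N₁ N₂
    · rw [Set.indicator_of_mem h, Set.indicator_of_mem (hiff.mp h), mul_one]
    · rw [Set.indicator_of_notMem h, Set.indicator_of_notMem (fun h' => h (hiff.mpr h')), mul_zero]
  have hset : Set.Ioi (0 : ℝ) ∩ Set.Ico r₁ r₂ = Set.Ico r₁ r₂ := by
    ext r; simp only [Set.mem_inter_iff, Set.mem_Ioi, Set.mem_Ico]
    constructor
    · exact fun h => h.2
    · exact fun h => ⟨hr₁0.trans_le h.1, h⟩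
  rw [setIntegral_congr_fun measurableSet_Ioi key, setIntegral_indicator measurableSet_Ico, hset,
    setIntegral_congr_set Ico_ae_eq_Ioc, ← intervalIntegral.integral_of_le hr₁₂, integral_id, hr₁, hr₂,
    Real.sq_sqrt (div_nonneg (hN₁.le.trans hN) hy.le), Real.sq_sqrt (div_nonneg hN₁.le hy.le)]
  field_simp

/-- **The unit-coordinate integral**: `∫_{y>0, σ(y) ∈ [−1/2,1/2)} h(2πσ(y)) dy/y = vΔ`,
`σ(y) = (log y − log y_b)/v` (the substitution `s = σ(y)`, `dy/y = v ds`, and `∫ tentPer = Δ`; the last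
factor of the "easy calculation" on p. 60). [cite: HeathBrownActa2001, §9 p. 60] -/
theorem integral_unitCoord_factor {Δ yb : ℝ} (hΔ : 0 < Δ) (hΔ2 : Δ ≤ 1 / 2) (hyb : 0 < yb) :
    ∫ y in Set.Ioi (0 : ℝ), (Set.Ico (-(1 / 2 : ℝ)) (1 / 2)).indicator (fun _ => (1 : ℝ))
        ((Real.log y - Real.log yb) / unitLog) * tentPer Δ ((Real.log y - Real.log yb) / unitLog) / y =
      unitLog * Δ := by
  have hv := unitLog_pos
  set σ : ℝ → ℝ := fun y => (Real.log y - Real.log yb) / unitLog with hσ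
  set y₁ : ℝ := yb * Real.exp (-(unitLog / 2)) with hy₁
  set y₂ : ℝ := yb * Real.exp (unitLog / 2) with hy₂
  have hy₁0 : 0 < y₁ := by positivity
  have hy₁₂ : y₁ ≤ y₂ := by rw [hy₁, hy₂]; gcongr; linarith
  have hσ₁ : σ y₁ = -(1 / 2) := by
    simp only [hσ, hy₁]; rw [Real.log_mul hyb.ne' (Real.exp_pos _).ne', Real.log_exp]; field_simp; ring
  have hσ₂ : σ y₂ = 1 / 2 := by
    simp only [hσ, hy₂]; rw [Real.log_mul hyb.ne' (Real.exp_pos _).ne', Real.log_exp]; field_simp; ring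
  -- `σ(y) ∈ [−1/2, 1/2)` iff `y ∈ [y₁, y₂)` for `y > 0`
  have hiff : ∀ y : ℝ, 0 < y → (σ y ∈ Set.Ico (-(1 / 2 : ℝ)) (1 / 2) ↔ y ∈ Set.Ico y₁ y₂) := by
    intro y hy
    rw [Set.mem_Ico, Set.mem_Ico, ← hσ₁, ← hσ₂]
    simp only [hσ]
    rw [div_le_div_iff_of_pos_right hv, div_lt_div_iff_of_pos_right hv, sub_le_sub_iff_right, sub_lt_sub_iff_right,
      Real.log_le_log_iff hy₁0 hy, Real.log_lt_log_iff hy (hy₁0.trans_le hy₁₂)]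
  have key : ∀ y ∈ Set.Ioi (0 : ℝ), (Set.Ico (-(1 / 2 : ℝ)) (1 / 2)).indicator (fun _ => (1 : ℝ)) (σ y) * tentPer Δ (σ y) / y =
      (Set.Ico y₁ y₂).indicator (fun y => tentPer Δ (σ y) / y) y := by
    intro y hy
    by_cases h : σ y ∈ Set.Ico (-(1 / 2 : ℝ)) (1 / 2)
    · rw [Set.indicator_of_mem h, Set.indicator_of_mem ((hiff y hy).mp h), one_mul]
    · rw [Set.indicator_of_notMem h, Set.indicator_of_notMem (fun h' => h ((hiff y hy).mpr h')), zero_mul, zero_div]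
  have hset : Set.Ioi (0 : ℝ) ∩ Set.Ico y₁ y₂ = Set.Ico y₁ y₂ := by
    ext y; simp only [Set.mem_inter_iff, Set.mem_Ioi, Set.mem_Ico]
    exact ⟨fun h => h.2, fun h => ⟨hy₁0.trans_le h.1, h⟩⟩
  rw [show (fun y : ℝ => (Set.Ico (-(1 / 2 : ℝ)) (1 / 2)).indicator (fun _ => (1 : ℝ)) ((Real.log y - Real.log yb) / unitLog) *
      tentPer Δ ((Real.log y - Real.log yb) / unitLog) / y) = fun y => (Set.Ico (-(1 / 2 : ℝ)) (1 / 2)).indicator (fun _ => (1 : ℝ)) (σ y) *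
      tentPer Δ (σ y) / y from rfl]
  rw [setIntegral_congr_fun measurableSet_Ioi key, setIntegral_indicator measurableSet_Ico, hset,
    setIntegral_congr_set Ico_ae_eq_Ioc, ← intervalIntegral.integral_of_le hy₁₂]
  -- substitution `s = σ(y)`
  have hderiv : ∀ y ∈ Set.uIcc y₁ y₂, HasDerivAt σ (1 / (unitLog * y)) y := by
    intro y hy
    rw [Set.uIcc_of_le hy₁₂] at hy
    have hy0 : 0 < y := hy₁0.trans_le hy.1
    have h1 : HasDerivAt (fun y => (Real.log y - Real.log yb) / unitLog) (y⁻¹ / unitLog) y :=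
      ((Real.hasDerivAt_log hy0.ne').sub_const (Real.log yb)).div_const unitLog
    convert h1 using 1; field_simp
  have hcont : ContinuousOn (fun y => 1 / (unitLog * y)) (Set.uIcc y₁ y₂) := by
    apply ContinuousOn.div continuousOn_const (by fun_prop)
    intro y hy; rw [Set.uIcc_of_le hy₁₂] at hy
    exact (mul_pos hv (hy₁0.trans_le hy.1)).ne'
  have hg : ContinuousOn (fun u => unitLog * tentPer Δ u) (σ '' Set.uIcc y₁ y₂) :=
    (continuous_const.mul (continuous_tentPer Δ)).continuousOn
  have hsub := intervalIntegral.integral_comp_mul_deriv' hderiv hcont hg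
  rw [hσ₁, hσ₂] at hsub
  have heq : ∀ y ∈ Set.uIcc y₁ y₂, tentPer Δ (σ y) / y = ((fun u => unitLog * tentPer Δ u) ∘ σ) y * (1 / (unitLog * y)) := by
    intro y hy
    rw [Set.uIcc_of_le hy₁₂] at hy
    have hy0 : 0 < y := hy₁0.trans_le hy.1
    simp only [Function.comp_apply]; field_simp
  rw [intervalIntegral.integral_congr heq, hsub, intervalIntegral.integral_const_mul,
    show (-(1 / 2 : ℝ)) = -(1 / 2) from rfl]
  have := integral_tentPer hΔ hΔ2 (-(1 / 2))
  rw [show (-(1 / 2 : ℝ) + 1) = 1 / 2 by norm_num] at this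
  rw [this]

/-! ### The integrand in the coordinates `(y, z) = (β(𝐱), β'(𝐱))` -/

section OrbitG

variable (Δ V : ℝ) (b : ℝ × ℝ × ℝ)

/-- `σ(y) = (log y − log β(b))/v`, the unit coordinate as a function of `y = β(𝐱)`. [folklore] -/
def sigmaOf (y : ℝ) : ℝ := (Real.log y - Real.log (ell b)) / unitLog

/-- The radial-in-`y` factor `A(y) = 𝟙[y > 0] 𝟙[σ(y) ∈ [−1/2,1/2)] h(2πσ(y))`. [folklore] -/
def orbitA (y : ℝ) : ℝ :=
  (Set.Ioi (0 : ℝ)).indicator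
    (fun y => (Set.Ico (-(1 / 2 : ℝ)) (1 / 2)).indicator (fun _ => (1 : ℝ)) (sigmaOf b y) * tentPer Δ (sigmaOf b y)) y

/-- The factor `B(y, z) = 𝟙[N(b) − ΔV ≤ y|z|² < N(b)] h(φ_b + uσ(y) − arg z)` (`z` in real coordinates).
[folklore] -/
def orbitB (y : ℝ) (p : ℝ × ℝ) : ℝ :=
  (Set.Ico (normForm b - Δ * V) (normForm b)).indicator (fun _ => (1 : ℝ)) (y * (p.1 ^ 2 + p.2 ^ 2)) *
    tentPer Δ ((Complex.arg (cplxEmb b) + unitArg * sigmaOf b y - Complex.arg (Complex.equivRealProd.symm p)) /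
      (2 * Real.pi))

/-- **The orbit integrand in the coordinates `(y, Re z, Im z)`**: `G = A(y) B(y, z)`. [folklore] -/
def orbitG (q : ℝ × ℝ × ℝ) : ℝ := orbitA Δ b q.1 * orbitB Δ V b q.1 q.2

variable {Δ V b}

/-- **The inner integral over `z`** (polar coordinates in the `z`-plane, `I₁(y) · I₂ = (ΔV/2y)(2πΔ)`):
for `y > 0` (and `0 < N(b) − ΔV`), `∫_z B(y, z) = (ΔV/(2y))·(2πΔ)`. [cite: HeathBrownActa2001, §9 p. 60] -/
theorem integral_orbitB (hΔ : 0 < Δ) (hΔ2 : Δ ≤ 1 / 2) (hV : 0 < V) (hN : Δ * V < normForm b) {y : ℝ} (hy : 0 < y) :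
    ∫ p, orbitB Δ V b y p = Δ * V / (2 * y) * (2 * Real.pi * Δ) := by
  rw [← integral_comp_polarCoord_symm]
  set d : ℝ := Complex.arg (cplxEmb b) + unitArg * sigmaOf b y with hd
  have key : ∀ q ∈ polarCoord.target, q.1 • orbitB Δ V b y (polarCoord.symm q) =
      (q.1 * (Set.Ico (normForm b - Δ * V) (normForm b)).indicator (fun _ => (1 : ℝ)) (y * q.1 ^ 2)) *
        tentPer Δ ((d - q.2) / (2 * Real.pi)) := by
    rintro ⟨r, θ⟩ ⟨hr, hθ⟩
    simp only [Set.mem_Ioi] at hr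
    simp only [Set.mem_Ioo] at hθ
    have h1 : (r * Real.cos θ) ^ 2 + (r * Real.sin θ) ^ 2 = r ^ 2 := by
      nlinarith [Real.cos_sq_add_sin_sq θ]
    have h2 : Complex.arg (Complex.equivRealProd.symm (r * Real.cos θ, r * Real.sin θ)) = θ := by
      rw [Complex.equivRealProd_symm_apply]
      have : ((r * Real.cos θ : ℝ) : ℂ) + ((r * Real.sin θ : ℝ) : ℂ) * Complex.I =
          r * (Complex.cos θ + Complex.sin θ * Complex.I) := by push_cast; ring
      rw [this, Complex.arg_mul_cos_add_sin_mul_I hr ⟨hθ.1, hθ.2.le⟩]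
    simp only [polarCoord_symm_apply, smul_eq_mul, orbitB, h1, h2, hd]
    ring
  rw [setIntegral_congr_fun polarCoord.open_target.measurableSet key]
  rw [show polarCoord.target = Set.Ioi (0 : ℝ) ×ˢ Set.Ioo (-Real.pi) Real.pi from rfl, Measure.volume_eq_prod,
    setIntegral_prod_mul (fun r : ℝ => r * (Set.Ico (normForm b - Δ * V) (normForm b)).indicator (fun _ => (1 : ℝ)) (y * r ^ 2))
      (fun θ : ℝ => tentPer Δ ((d - θ) / (2 * Real.pi))),
    integral_radial hy (by linarith) (by nlinarith), setIntegral_congr_set Ioo_ae_eq_Ioc,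
    ← intervalIntegral.integral_of_le (by linarith [Real.pi_pos]), integral_tentPer_angle hΔ hΔ2]
  ring

end OrbitG

section OrbitG2

variable {Δ V : ℝ} {b : ℝ × ℝ × ℝ}

/-- `σ` is measurable. [folklore] -/
theorem measurable_sigmaOf (b : ℝ × ℝ × ℝ) : Measurable (sigmaOf b) :=
  (Real.measurable_log.sub_const _).div_const _

/-- `A` is measurable. [folklore] -/
theorem measurable_orbitA (Δ : ℝ) (b : ℝ × ℝ × ℝ) : Measurable (orbitA Δ b) := by
  unfold orbitA
  refine Measurable.indicator ?_ measurableSet_Ioi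
  refine Measurable.mul ?_ ((continuous_tentPer Δ).measurable.comp (measurable_sigmaOf b))
  exact (measurable_const.indicator measurableSet_Ico).comp (measurable_sigmaOf b)

/-- `(y, p) ↦ B(y, p)` is measurable. [folklore] -/
theorem measurable_orbitB (Δ V : ℝ) (b : ℝ × ℝ × ℝ) : Measurable (fun q : ℝ × ℝ × ℝ => orbitB Δ V b q.1 q.2) := by
  unfold orbitB
  refine Measurable.mul ?_ ?_
  · refine (measurable_const.indicator measurableSet_Ico).comp ?_
    fun_prop
  · refine (continuous_tentPer Δ).measurable.comp ?_
    refine Measurable.div_const (Measurable.sub (measurable_const.add (measurable_const.mul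
      ((measurable_sigmaOf b).comp measurable_fst))) ?_) _
    have h : (fun q : ℝ × ℝ × ℝ => Complex.arg (Complex.equivRealProd.symm q.2)) =
        fun q : ℝ × ℝ × ℝ => Complex.arg ((q.2.1 : ℂ) + (q.2.2 : ℂ) * Complex.I) := by
      funext q; rw [Complex.equivRealProd_symm_apply]
    rw [h]
    exact Complex.measurable_arg.comp (by fun_prop)

/-- `G` is measurable. [folklore] -/
theorem measurable_orbitG (Δ V : ℝ) (b : ℝ × ℝ × ℝ) : Measurable (orbitG Δ V b) :=
  ((measurable_orbitA Δ b).comp measurable_fst).mul (measurable_orbitB Δ V b)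

/-- `|A| ≤ 1`. [folklore] -/
theorem abs_orbitA_le (hΔ : 0 < Δ) (b : ℝ × ℝ × ℝ) (y : ℝ) : |orbitA Δ b y| ≤ 1 := by
  unfold orbitA
  by_cases hy : y ∈ Set.Ioi (0 : ℝ)
  · rw [Set.indicator_of_mem hy]
    by_cases hs : sigmaOf b y ∈ Set.Ico (-(1 / 2 : ℝ)) (1 / 2)
    · rw [Set.indicator_of_mem hs, one_mul, abs_of_nonneg (tentPer_nonneg _ _)]; exact tentPer_le_one hΔ _
    · rw [Set.indicator_of_notMem hs, zero_mul, abs_zero]; exact zero_le_one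
  · rw [Set.indicator_of_notMem hy, abs_zero]; exact zero_le_one

/-- `|B| ≤ 1`. [folklore] -/
theorem abs_orbitB_le (hΔ : 0 < Δ) (V : ℝ) (b : ℝ × ℝ × ℝ) (y : ℝ) (p : ℝ × ℝ) : |orbitB Δ V b y p| ≤ 1 := by
  unfold orbitB
  by_cases h : y * (p.1 ^ 2 + p.2 ^ 2) ∈ Set.Ico (normForm b - Δ * V) (normForm b)
  · rw [Set.indicator_of_mem h, one_mul, abs_of_nonneg (tentPer_nonneg _ _)]; exact tentPer_le_one hΔ _
  · rw [Set.indicator_of_notMem h, zero_mul, abs_zero]; exact zero_le_one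

/-- `|G| ≤ 1`. [folklore] -/
theorem abs_orbitG_le (hΔ : 0 < Δ) (V : ℝ) (b : ℝ × ℝ × ℝ) (q : ℝ × ℝ × ℝ) : |orbitG Δ V b q| ≤ 1 := by
  rw [orbitG, abs_mul]
  exact mul_le_one₀ (abs_orbitA_le hΔ b _) (abs_nonneg _) (abs_orbitB_le hΔ V b _ _)

/-- **The support of `G` is bounded**: `y ∈ [β(b)e^{−v/2}, β(b)e^{v/2}]` and `|Re z|, |Im z| ≤ R`,
`R² = N(b)/(β(b)e^{−v/2})` (for `β(b) > 0`, `0 ≤ N(b) − ΔV`). [folklore] -/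
theorem orbitG_eq_zero_of_not_mem (hb : 0 < ell b) {q : ℝ × ℝ × ℝ}
    (hq : q ∉ Set.Icc (ell b * Real.exp (-(unitLog / 2))) (ell b * Real.exp (unitLog / 2)) ×ˢ
      (Set.Icc (-Real.sqrt (normForm b / (ell b * Real.exp (-(unitLog / 2))))) (Real.sqrt (normForm b / (ell b * Real.exp (-(unitLog / 2))))) ×ˢ
       Set.Icc (-Real.sqrt (normForm b / (ell b * Real.exp (-(unitLog / 2))))) (Real.sqrt (normForm b / (ell b * Real.exp (-(unitLog / 2))))))) :
    orbitG Δ V b q = 0 := by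
  have hv := unitLog_pos
  set y₁ : ℝ := ell b * Real.exp (-(unitLog / 2)) with hy₁
  set y₂ : ℝ := ell b * Real.exp (unitLog / 2) with hy₂
  set R : ℝ := Real.sqrt (normForm b / y₁) with hR
  have hy₁0 : 0 < y₁ := by positivity
  by_contra hne
  rw [orbitG] at hne
  obtain ⟨hA, hB⟩ := mul_ne_zero_iff.mp hne
  -- from `A ≠ 0`: `y ∈ (0, ∞)`, `σ(y) ∈ [-1/2, 1/2)`
  rw [orbitA] at hA
  have hy0 : q.1 ∈ Set.Ioi (0 : ℝ) := by by_contra h; exact hA (Set.indicator_of_notMem h _)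
  rw [Set.indicator_of_mem hy0] at hA
  have hσ : sigmaOf b q.1 ∈ Set.Ico (-(1 / 2 : ℝ)) (1 / 2) := by
    by_contra h; rw [Set.indicator_of_notMem h, zero_mul] at hA; exact hA rfl
  simp only [Set.mem_Ioi] at hy0
  have hyI : q.1 ∈ Set.Icc y₁ y₂ := by
    rw [Set.mem_Ico, sigmaOf, le_div_iff₀ hv, div_lt_iff₀ hv] at hσ
    rw [Set.mem_Icc, hy₁, hy₂]
    constructor
    · have : Real.log (ell b * Real.exp (-(unitLog / 2))) ≤ Real.log q.1 := by
        rw [Real.log_mul hb.ne' (Real.exp_pos _).ne', Real.log_exp]; linarith [hσ.1]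
      exact (Real.log_le_log_iff hy₁0 hy0).mp this
    · have : Real.log q.1 ≤ Real.log (ell b * Real.exp (unitLog / 2)) := by
        rw [Real.log_mul hb.ne' (Real.exp_pos _).ne', Real.log_exp]; linarith [hσ.2]
      exact (Real.log_le_log_iff hy0 (by positivity)).mp this
  -- from `B ≠ 0`: `y (a² + c²) < N(b)`
  rw [orbitB] at hB
  have hwin : q.1 * (q.2.1 ^ 2 + q.2.2 ^ 2) ∈ Set.Ico (normForm b - Δ * V) (normForm b) := by
    by_contra h; rw [Set.indicator_of_notMem h, zero_mul] at hB; exact hB rfl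
  have hsq : q.2.1 ^ 2 + q.2.2 ^ 2 ≤ normForm b / y₁ := by
    rw [le_div_iff₀ hy₁0]
    have h1 : y₁ ≤ q.1 := hyI.1
    have h2 := hwin.2
    nlinarith [sq_nonneg q.2.1, sq_nonneg q.2.2]
  have hNb : 0 ≤ normForm b := by
    have h2 := hwin.2
    nlinarith [mul_nonneg hy0.le (add_nonneg (sq_nonneg q.2.1) (sq_nonneg q.2.2))]
  have hRsq : R ^ 2 = normForm b / y₁ := Real.sq_sqrt (div_nonneg hNb hy₁0.le)
  have ha : q.2.1 ∈ Set.Icc (-R) R := by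
    rw [Set.mem_Icc, ← abs_le]; apply abs_le_of_sq_le_sq _ (Real.sqrt_nonneg _); rw [hRsq]; nlinarith [sq_nonneg q.2.2]
  have hc : q.2.2 ∈ Set.Icc (-R) R := by
    rw [Set.mem_Icc, ← abs_le]; apply abs_le_of_sq_le_sq _ (Real.sqrt_nonneg _); rw [hRsq]; nlinarith [sq_nonneg q.2.1]
  exact hq ⟨hyI, ha, hc⟩

/-- **`G` is integrable** (bounded by `1`, measurable, with bounded support). [folklore] -/
theorem integrable_orbitG (hΔ : 0 < Δ) (hb : 0 < ell b) :
    Integrable (orbitG Δ V b) := by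
  set y₁ : ℝ := ell b * Real.exp (-(unitLog / 2))
  set y₂ : ℝ := ell b * Real.exp (unitLog / 2)
  set R : ℝ := Real.sqrt (normForm b / y₁)
  set Box : Set (ℝ × ℝ × ℝ) := Set.Icc y₁ y₂ ×ˢ (Set.Icc (-R) R ×ˢ Set.Icc (-R) R) with hBox
  have hsupp : Function.support (orbitG Δ V b) ⊆ Box := by
    intro q hq
    by_contra h
    exact hq (orbitG_eq_zero_of_not_mem hb h)
  rw [← integrableOn_iff_integrable_of_support_subset hsupp]
  have hfin : volume Box ≠ ⊤ := by
    rw [hBox, Measure.volume_eq_prod, Measure.prod_prod, Measure.volume_eq_prod, Measure.prod_prod]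
    simp [Real.volume_Icc, ENNReal.mul_eq_top]
  refine Measure.integrableOn_of_bounded hfin (measurable_orbitG Δ V b).aestronglyMeasurable (M := 1) ?_
  exact Filter.Eventually.of_forall fun q => by rw [Real.norm_eq_abs]; exact abs_orbitG_le hΔ V b q

/-- **The integral of `G`**: `∫ G = πvΔ³V` (Fubini: `∫_y A(y) ∫_z B(y,z) = ∫_y A(y)(ΔV/2y)(2πΔ) = πΔ²V·vΔ`).
[cite: HeathBrownActa2001, §9 p. 60] -/
theorem integral_orbitG (hΔ : 0 < Δ) (hΔ2 : Δ ≤ 1 / 2) (hV : 0 < V) (hb : 0 < ell b) (hN : Δ * V < normForm b) :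
    ∫ q, orbitG Δ V b q = Real.pi * unitLog * Δ ^ 3 * V := by
  have hint := integrable_orbitG hΔ hb (V := V)
  rw [Measure.volume_eq_prod] at hint ⊢
  rw [integral_prod _ hint]
  simp only [orbitG]
  simp_rw [integral_const_mul]
  -- restrict to `y > 0`
  have h1 : ∀ y : ℝ, orbitA Δ b y * ∫ p, orbitB Δ V b y p =
      (Set.Ioi (0 : ℝ)).indicator (fun y => ((Set.Ico (-(1 / 2 : ℝ)) (1 / 2)).indicator (fun _ => (1 : ℝ)) (sigmaOf b y) *
        tentPer Δ (sigmaOf b y)) * (Δ * V / (2 * y) * (2 * Real.pi * Δ))) y := by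
    intro y
    by_cases hy : y ∈ Set.Ioi (0 : ℝ)
    · rw [orbitA, Set.indicator_of_mem hy, Set.indicator_of_mem hy, integral_orbitB hΔ hΔ2 hV hN hy]
    · rw [orbitA, Set.indicator_of_notMem hy, Set.indicator_of_notMem hy, zero_mul]
  simp_rw [h1]
  rw [integral_indicator measurableSet_Ioi]
  have h2 : ∀ y ∈ Set.Ioi (0 : ℝ), ((Set.Ico (-(1 / 2 : ℝ)) (1 / 2)).indicator (fun _ => (1 : ℝ)) (sigmaOf b y) *
        tentPer Δ (sigmaOf b y)) * (Δ * V / (2 * y) * (2 * Real.pi * Δ)) =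
      (Real.pi * Δ ^ 2 * V) * ((Set.Ico (-(1 / 2 : ℝ)) (1 / 2)).indicator (fun _ => (1 : ℝ))
        ((Real.log y - Real.log (ell b)) / unitLog) * tentPer Δ ((Real.log y - Real.log (ell b)) / unitLog) / y) := by
    intro y hy
    simp only [Set.mem_Ioi] at hy
    rw [sigmaOf]; field_simp
  rw [setIntegral_congr_fun measurableSet_Ioi h2, integral_const_mul, integral_unitCoord_factor hΔ hΔ2 hb]
  ring

end OrbitG2

/-! ### The orbit integral `I(β) = γ₀Δ³V` -/

section Orbit

variable (Δ V : ℝ) (b : ℝ × ℝ × ℝ)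

/-- **The orbit set `D(b)`**: the `𝐱` with `β(𝐱) > 0` on the branch of `b` (`Near b 𝐱`) and in the norm
window `N(b) − ΔV ≤ N(𝐱) < N(b)` — the domain of integration "`𝐱 ∈ 𝓕, N(𝐱) < N(β) ≤ N(𝐱) + ΔV`" of
`I(β)` (p. 59), with the branch in place of the fundamental domain. [cite: HeathBrownActa2001, §9 p. 59] -/
def orbitSet : Set (ℝ × ℝ × ℝ) :=
  {x | 0 < ell x ∧ Near b x ∧ (normForm b - Δ * V ≤ normForm x ∧ normForm x < normForm b)}

/-- **The orbit integrand** `𝟙_{D(b)}(𝐱) W(b; Δ, 𝐱)`, whose integral is `I(β)` (p. 59).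
[cite: HeathBrownActa2001, §9 p. 59] -/
def orbitIntegrand (x : ℝ × ℝ × ℝ) : ℝ := (orbitSet Δ V b).indicator (pairWeight Δ b) x

variable {Δ V b}

/-- `σ(b, 𝐱) = σ(β(𝐱))`. [folklore] -/
theorem unitCoord_eq_sigmaOf (b x : ℝ × ℝ × ℝ) : unitCoord b x = sigmaOf b (ell x) := rfl

/-- **The orbit integrand in the embedding coordinates**: `𝟙_{D(b)} W(b; Δ, ·) = G ∘ T` pointwise
(`β(b) > 0`, `N(b) − ΔV > 0`). [cite: HeathBrownActa2001, §9 p. 59] -/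
theorem orbitIntegrand_eq_orbitG (hb : 0 < ell b) (hΔV : 0 ≤ Δ * V) (hN : 0 < normForm b - Δ * V)
    (x : ℝ × ℝ × ℝ) : orbitIntegrand Δ V b x = orbitG Δ V b (embT x) := by
  have hNb : 0 < normForm b := by linarith
  have hb' : cplxEmb b ≠ 0 := cplxEmb_ne_zero_of_normForm_ne_zero hNb.ne'
  have hNx : normForm x = ell x * ((cplxEmb x).re ^ 2 + (cplxEmb x).im ^ 2) := by
    rw [← ell_mul_normSq_cplxEmb, Complex.normSq_apply]; ring
  have hz : Complex.equivRealProd.symm ((cplxEmb x).re, (cplxEmb x).im) = cplxEmb x := by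
    rw [Complex.equivRealProd_symm_apply, Complex.re_add_im]
  rw [orbitIntegrand, orbitG, embT_apply]
  simp only
  by_cases hx : x ∈ orbitSet Δ V b
  · obtain ⟨hx0, hnear, hwin⟩ := hx
    have hNx0 : 0 < normForm x := lt_of_lt_of_le hN hwin.1
    have hx' : cplxEmb x ≠ 0 := cplxEmb_ne_zero_of_normForm_ne_zero hNx0.ne'
    rw [Set.indicator_of_mem (show x ∈ orbitSet Δ V b from ⟨hx0, hnear, hwin⟩), orbitA,
      Set.indicator_of_mem (show ell x ∈ Set.Ioi (0 : ℝ) from hx0), ← unitCoord_eq_sigmaOf,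
      Set.indicator_of_mem (show unitCoord b x ∈ Set.Ico (-(1 / 2 : ℝ)) (1 / 2) from hnear), one_mul, orbitB,
      ← hNx, Set.indicator_of_mem (show normForm x ∈ Set.Ico (normForm b - Δ * V) (normForm b) from hwin), one_mul, hz,
      ← unitCoord_eq_sigmaOf, pairWeight, angTent_nu1_div hb hb' hx0 hx', angTent_nu2_div hb hx0, mul_comm]
    congr 2; ring
  · rw [Set.indicator_of_notMem hx]
    by_cases hx0 : 0 < ell x
    · by_cases hnear : Near b x
      · have hwin : ¬ (normForm b - Δ * V ≤ normForm x ∧ normForm x < normForm b) := fun h => hx ⟨hx0, hnear, h⟩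
        rw [orbitB, ← hNx, Set.indicator_of_notMem (show normForm x ∉ Set.Ico (normForm b - Δ * V) (normForm b) from hwin),
          zero_mul, mul_zero]
      · rw [orbitA, Set.indicator_of_mem (show ell x ∈ Set.Ioi (0 : ℝ) from hx0), ← unitCoord_eq_sigmaOf,
          Set.indicator_of_notMem (show unitCoord b x ∉ Set.Ico (-(1 / 2 : ℝ)) (1 / 2) from hnear), zero_mul, zero_mul]
    · rw [orbitA, Set.indicator_of_notMem (show ell x ∉ Set.Ioi (0 : ℝ) from hx0), zero_mul]

/-- **`I(β) = γ₀Δ³V`** (Heath-Brown p. 59–60: "We make a change of variables by setting `β(𝐱) = y`,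
`β'(𝐱) = z`. A straightforward computation shows that the Jacobian of this transformation is … Thus
`I(β) = … ∫ h(θ₂ − 2πv⁻¹ log y) I₁(y) I₂(y) dy`, where `I₁(y) = ∫_{N(β)−ΔV ≤ r²y < N(β)} r dr = ΔV/2y` and
`I₂(y) = ∫ h(θ₁ − … − θ) dθ = 2πΔ`. An easy calculation now reveals that `I(β) = (πv/(3√3))Δ³V = γ₀Δ³V`"):
for `0 < Δ ≤ 1/2`, `V > 0`, `β(b) > 0` and `ΔV < N(b)`, the integral over the orbit set `D(b)` of
`W(b; Δ, 𝐱)` is `γ₀Δ³V`, `γ₀ = π log E/(3√3)` the residue of `ζ_K` (`gamma₀_eq`). [cite: HeathBrownActa2001, §9 p. 60] -/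
theorem integral_orbitIntegrand (hΔ : 0 < Δ) (hΔ2 : Δ ≤ 1 / 2) (hV : 0 < V) (hb : 0 < ell b)
    (hN : Δ * V < normForm b) : ∫ x, orbitIntegrand Δ V b x = gamma₀ * Δ ^ 3 * V := by
  have h1 : (fun x => orbitIntegrand Δ V b x) = fun x => orbitG Δ V b (embT x) :=
    funext (orbitIntegrand_eq_orbitG hb (by positivity) (by linarith))
  rw [h1, integral_comp_embT (orbitG Δ V b), integral_orbitG hΔ hΔ2 hV hb hN, gamma₀_eq, unitLog]
  have h3 : Real.sqrt 3 ≠ 0 := by positivity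
  field_simp

/-- `0 ≤ 𝟙_D W ≤ 1`. [folklore] -/
theorem orbitIntegrand_nonneg (Δ V : ℝ) (b x : ℝ × ℝ × ℝ) : 0 ≤ orbitIntegrand Δ V b x :=
  Set.indicator_nonneg (fun _ _ => pairWeight_nonneg _ _ _) _

/-- `𝟙_D W ≤ 1` (`Δ > 0`). [folklore] -/
theorem orbitIntegrand_le_one (hΔ : 0 < Δ) (V : ℝ) (b x : ℝ × ℝ × ℝ) : orbitIntegrand Δ V b x ≤ 1 :=
  Set.indicator_le' (fun _ _ => pairWeight_le_one hΔ _ _) (fun _ _ => zero_le_one) x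

/-- **The orbit integrand is integrable** on `ℝ³` (`β(b) > 0`, `ΔV < N(b)`). [folklore] -/
theorem integrable_orbitIntegrand (hΔ : 0 < Δ) (hV : 0 < V) (hb : 0 < ell b) (hN : Δ * V < normForm b) :
    Integrable (orbitIntegrand Δ V b) := by
  have h1 : (fun x => orbitIntegrand Δ V b x) = fun x => orbitG Δ V b (embT x) :=
    funext (orbitIntegrand_eq_orbitG hb (by positivity) (by linarith))
  rw [show orbitIntegrand Δ V b = fun x => orbitIntegrand Δ V b x from rfl, h1]
  let e : (ℝ × ℝ × ℝ) ≃ᵐ (ℝ × ℝ × ℝ) := embTEquiv.toHomeomorph.toMeasurableEquiv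
  have hecoe : (⇑e : (ℝ × ℝ × ℝ) → ℝ × ℝ × ℝ) = ⇑embT := by
    funext x; exact embTEquiv_apply x
  have he : (fun x => orbitG Δ V b (embT x)) = (orbitG Δ V b) ∘ e := by
    funext x; simp [Function.comp_apply, hecoe]
  rw [he, ← integrable_map_equiv, hecoe, map_embT_volume]
  exact (integrable_orbitG hΔ hb).smul_measure ENNReal.ofReal_ne_top

end Orbit

end Literature.NumberTheory.Sieve.CubicSieve
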